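import Literature.AlgebraicGeometry.Milne1999.CMTypeSimpleIsogenyFactors
import Literature.AlgebraicGeometry.HodgeTheory.LefschetzOneOneHolds
import Literature.AlgebraicGeometry.Motives.AlbaneseByMaximality
import HarnessLib

/-!
# The (I) → (H) → Tate chain over the binder `hSimple` AT POSITIVE DIMENSION (erratum and repair)

ERRATUM to `Milne1999/TateFromCodesHCOfHSimple` (and to the binders `hSimple`, `hSimpleSub`,
`hDecomp`, `hDom` of `Milne1999/CMHodgeHypothesisFromCMTypedProducts`, `CMHodgeHypothesisFromRealisations`,
`TateFromCodesHC`, `ComplexMultiplication/CMTypeOfSimpleSubvariety`).  Those binders quantify over ALL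
complex abelian varieties `B` (resp. `A`), including the ZERO abelian variety, which the tree's
`AbelianVariety.IsSimple` admits («so is the zero abelian variety under this convention»,
`Motives/AbelianVariety`) and which is of CM-type in the étale sense (`isOfCMType_of_dim_eq_zero`).
But a CM-typed abelian variety (`IsCMTyped`: a realisation of a CM type of a CM field `K`, of
dimension `[K:ℚ]/2 ≥ 1`) has POSITIVE dimension (`IsCMTyped.dim_pos` below), and so has anything
isogenous to it; hence each of those binders, as typed, implies «every complex abelian variety has
positive dimension» (`forall_dim_pos_of_hSimple`) — they are unsatisfiable as soon as a zero abelian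
variety is exhibited, and the composite edges over them are vacuous.  The intended content is
untouched: Milne's «simple» means non-zero (Milne 1986 §12 p. 122 «no proper nonzero abelian
subvarieties»), and the Hodge conjecture for a zero-dimensional variety is trivial.

This file re-issues the chain over the binder RESTRICTED TO POSITIVE DIMENSION,
`hSimplePos : ∀ B, IsSimple B → 0 < B.dim → IsOfCMType B → ∃ B′, IsCMTyped B′ ∧ IsIsogenous B B′`
(Shimura 1998 §5.1 Props. 5–6 with Lemma 2, §5.2, §7.1 Prop. 7 — of which the tree now has: `End⁰(B)`
is a commutative field of degree `2 dim B` (`endAlgebra_comm_and_finrank_eq_of_isSimple_of_isOfCMType`),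
totally complex and acting on `H¹` with a CM type (`endField_isTotallyComplex_of_isSimple`,
`exists_cmType`, file `ComplexMultiplication/CMFieldActionHOne`, not imported here); NOT in the tree:
that field is CM (Rosati positivity) and principalisation), and
treats dimension `0` by the tree's unconditional Hodge conjecture in dimension `≤ 3`
(`hodgeConjectureFor_of_dim_le_three_holds`):

* `exists_isogeny_from_productOf_simple_pos_of_hereditary` — Poincaré's hereditary decomposition with
  POSITIVE-dimensional simple factors, for `0 < dim A` (the tree's proof, with the dimensions tracked);
* `hDecompPos_of_hSimplePos`, `hDomPos_of_hDecompPos` — the guarded decomposition / coding steps;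
* `forall_cmHodgeHypothesisAt_of_codesHC_pos` — (I) ⟹ (H) from `CodesHC`, guarded `hDomPos`, and the
  kernel inputs (`hodgePQ_independent_of_hodgeModel_holds`, `isogenyInvariance_hodgeConjectureFor`,
  `hodgeConjectureFor_of_dim_le_three_holds` at dimension `0`);
* `forall_cmHodgeHypothesisAt_of_codesHC_of_hSimplePos`, `forall_cmHodgeHypothesisAt_iff_codesHC_pos`,
  `tateAV_Fq_of_codesHC_pos`, `tate_and_hodgeStandard_of_codesHC_pos` — the chain of
  `TateFromCodesHCOfHSimple` with `hSimple` replaced by `hSimplePos`;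
* `IsCMTyped.dim_pos`, `forall_dim_pos_of_hSimple`, `AbelianVariety.dim_trivial`, **`not_hSimple`** —
  the unguarded binder is REFUTED: the trivial abelian variety `AbelianVariety.trivial ℂ` (tree,
  `Motives/AlbaneseByMaximality`) has dimension `0`.

Theorems only; no definition, no named fact (D-0026).

## References
* [Milne1999] J. S. Milne, Lefschetz motives and the Tate conjecture, Compositio Math. 117 (1999),
  §2 p. 54, §7 Thm. 7.1 p. 72.
* [Milne1986AbelianVarieties] J. S. Milne, Abelian varieties, in Cornell–Silverman (1986), §12 p. 122
  and Prop. 12.1.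
* [Shimura1998] G. Shimura, *Abelian Varieties with Complex Multiplication and Modular Functions*
  (1998), §5.1 Props. 1–6, §5.2, §6.1 Cor. of Thm. 2 (p. 41), §7.1 Prop. 7.
* [MumfordAV1970] D. Mumford, *Abelian Varieties* (1970), §19 Thm. 1 Cor. 1 (pp. 173–174).
* [VoisinHodgeII2003] C. Voisin, Hodge Theory and Complex Algebraic Geometry II, proof of Prop. 10.26
  (the Hodge conjecture in dimension `≤ 3`).

(Maintenance re-land 2026-08-20, no content change: triggers the hub rebuild of this file and the chain above it
— `CMTypedOfPrincipalCMPair → PrincipalModelOfCMOrder → TateFromCodesHCOfRiemann` — whose Lake traces had been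
imported from another workspace ahead of their `.olean`s.)
-/

noncomputable section

open CategoryTheory CategoryTheory.Limits AlgebraicGeometry MonoidalCategory

universe u

/-! ## §1 Poincaré's hereditary decomposition with positive-dimensional simple factors -/

namespace Literature.AlgebraicGeometry.Motives.AbelianVariety

variable {K : Type u} [Field K] [IsAlgClosed K]

/-- Auxiliary form (strong induction on the dimension). [folklore] -/
private theorem exists_isogeny_from_productOf_simple_pos_aux (Q : AbelianVariety K → Prop)
    (hQ : ∀ (A B : AbelianVariety K) (f : B ⟶ A), IsClosedImmersion (Hom.toSchemeHom f) → Q A → Q B)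
    (n : ℕ) :
    ∀ A : AbelianVariety K, A.dim = n → 0 < A.dim → Q A →
      ∃ (P : AbelianVariety K) (g : P ⟶ A),
        IsProductOf (fun B ↦ IsSimple B ∧ 0 < B.dim ∧ Q B) P ∧ IsIsogeny g := by
  induction n using Nat.strong_induction_on with
  | _ n ih =>
    intro A hA hA0 hQA
    by_cases hs : IsSimple A
    · exact ⟨A, 𝟙 A, .atom ⟨hs, hA0, hQA⟩, isIsogeny_id A⟩
    · obtain ⟨B, f, hf, hB0, hBA⟩ := exists_abelianSubvariety_of_not_isSimple hs
      haveI := hf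
      obtain ⟨Z, j, hj, hσ⟩ := poincare_complete_reducibility f
      have hdim : B.dim + Z.dim = A.dim := by
        rw [← dim_prod, ← dim_eq_of_isIsogeny (isIsogeny_hom_of_iso (biprodIsoProd B Z)),
          dim_eq_of_isIsogeny hσ]
      obtain ⟨P₁, g₁, hP₁, hg₁⟩ := ih B.dim (by omega) B rfl hB0 (hQ A B f hf hQA)
      obtain ⟨P₂, g₂, hP₂, hg₂⟩ := ih Z.dim (by omega) Z rfl (by omega) (hQ A Z j hj hQA)
      exact ⟨P₁.prod P₂, prodMap g₁ g₂ ≫ (biprodIsoProd B Z).inv ≫ biprod.desc f j, .prod hP₁ hP₂,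
        isIsogeny_comp (isIsogeny_prodMap hg₁ hg₂)
          (isIsogeny_comp (isIsogeny_hom_of_iso (biprodIsoProd B Z).symm) hσ)⟩

/-- **Hereditary Poincaré decomposition with positive-dimensional simple factors.**  For a property
`Q` inherited by abelian subvarieties and an abelian variety `A` of POSITIVE dimension with `Q A`,
there is an isogeny `P → A` from a finite product `P` of SIMPLE abelian varieties of POSITIVE
dimension, each satisfying `Q` (both pieces of Poincaré's splitting `B ⊞ Z → A` have
`0 < dim B, dim Z`). [cite: MumfordAV1970, §19 Thm. 1 Cor. 1 (pp. 173–174)]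
[cite: Milne1986AbelianVarieties, §12 Prop. 12.1 and p. 122 (PDF p. 189)] -/
theorem exists_isogeny_from_productOf_simple_pos_of_hereditary (Q : AbelianVariety K → Prop)
    (hQ : ∀ (A B : AbelianVariety K) (f : B ⟶ A), IsClosedImmersion (Hom.toSchemeHom f) → Q A → Q B)
    (A : AbelianVariety K) (hA : Q A) (hA0 : 0 < A.dim) :
    ∃ (P : AbelianVariety K) (g : P ⟶ A),
      IsProductOf (fun B ↦ IsSimple B ∧ 0 < B.dim ∧ Q B) P ∧ IsIsogeny g :=
  exists_isogeny_from_productOf_simple_pos_aux Q hQ A.dim A rfl hA0 hA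

end Literature.AlgebraicGeometry.Motives.AbelianVariety

namespace Literature.AlgebraicGeometry.Milne1999

open _root_.AlgebraicGeometry
open Literature.AlgebraicGeometry.Motives Literature.AlgebraicGeometry.HodgeTheory
open Literature.AlgebraicGeometry.ComplexMultiplication Literature.NumberTheory.Automorphic

/-! ## §2 The degeneracy of the unguarded binder -/

/-- **A CM-typed abelian variety has positive dimension**: a realisation of a CM type of a CM field
`K` has dimension `[K:ℚ]/2`, and `[K:ℚ] = 2 · #(complex places) ≥ 2`. [folklore] -/
theorem IsCMTyped.dim_pos {B : AbelianVariety ℂ} (hB : IsCMTyped B) : 0 < B.dim := by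
  obtain ⟨Φ, B, ι, θ, h⟩ := hB
  rename_i K _ _ _
  have hdim : B.dim = Module.finrank ℚ K / 2 := schemeDim_eq_holds h.1
  have hK : Module.finrank ℚ K = 2 * NumberField.InfinitePlace.nrComplexPlaces K :=
    NumberField.IsTotallyComplex.finrank K
  have hpos : 0 < Module.finrank ℚ K := Module.finrank_pos
  omega

/-- **The unguarded binder `hSimple` is degenerate**: it implies that EVERY complex abelian variety
has positive dimension (apply it to a zero abelian variety, which is simple and of CM-type in the
tree's conventions; anything isogenous to a CM-typed abelian variety has positive dimension).  Hence
the composite edges of `TateFromCodesHCOfHSimple` are vacuous as soon as a zero abelian variety is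
exhibited; the repaired binder is `hSimplePos` below. [folklore] -/
theorem forall_dim_pos_of_hSimple
    (hSimple : ∀ B : AbelianVariety ℂ, AbelianVariety.IsSimple B → IsOfCMType B →
      ∃ B' : AbelianVariety ℂ, IsCMTyped B' ∧ AbelianVariety.IsIsogenous B B') :
    ∀ B : AbelianVariety ℂ, 0 < B.dim := by
  intro B
  by_contra h0
  have hB0 : B.dim = 0 := Nat.eq_zero_of_not_pos h0
  obtain ⟨B', hB', f, hf⟩ := hSimple B (AbelianVariety.isSimple_of_dim_le_one (by omega))
    (isOfCMType_of_dim_eq_zero hB0)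
  have := hB'.dim_pos
  rw [← AbelianVariety.dim_eq_of_isIsogeny hf, hB0] at this
  exact lt_irrefl 0 this

/-- The identity of the trivial abelian variety is its zero endomorphism (all morphisms to the unit
object of `K`-schemes coincide). [folklore] -/
theorem _root_.Literature.AlgebraicGeometry.Motives.AbelianVariety.id_trivial_eq_zero
    {K : Type u} [Field K] :
    (𝟙 (AbelianVariety.trivial K) : AbelianVariety.trivial K ⟶ AbelianVariety.trivial K) = 0 :=
  AbelianVariety.hom_ext _ _
    ((inferInstance : Subsingleton (𝟙_ (SchemeOver K) ⟶ 𝟙_ (SchemeOver K))).elim _ _)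

/-- **The trivial abelian variety has dimension `0`** (otherwise its zero endomorphism, which is its
identity, would not be an isogeny: `not_isIsogeny_zero_of_dim_pos`). [folklore] -/
theorem _root_.Literature.AlgebraicGeometry.Motives.AbelianVariety.dim_trivial
    {K : Type u} [Field K] : (AbelianVariety.trivial K).dim = 0 := by
  by_contra h
  have h0 : 0 < (AbelianVariety.trivial K).dim := Nat.pos_of_ne_zero h
  have hid : AbelianVariety.IsIsogeny (0 : AbelianVariety.trivial K ⟶ AbelianVariety.trivial K) := by
    rw [← AbelianVariety.id_trivial_eq_zero]
    exact AbelianVariety.isIsogeny_id _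
  exact AbelianVariety.not_isIsogeny_zero_of_dim_pos h0 hid

/-- **REFUTATION of the unguarded binder `hSimple`** of `TateFromCodesHCOfHSimple` (and hence of
`hSimpleSub`, `hDecomp`, `hDom` as typed, which imply it at simple subvarieties / at `A = 0`): it is
FALSE, witnessed by the trivial abelian variety `AbelianVariety.trivial ℂ` of dimension `0`
(`forall_dim_pos_of_hSimple`).  The repaired binder is `hSimplePos` (§3). [folklore] -/
theorem not_hSimple :
    ¬ (∀ B : AbelianVariety ℂ, AbelianVariety.IsSimple B → IsOfCMType B →
      ∃ B' : AbelianVariety ℂ, IsCMTyped B' ∧ AbelianVariety.IsIsogenous B B') :=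
  fun h ↦ absurd (AbelianVariety.dim_trivial (K := ℂ)) (forall_dim_pos_of_hSimple h _).ne'

/-! ## §3 The chain over the guarded binder `hSimplePos` -/

/-- **The residual decomposition at positive dimension, from `hSimplePos`.**  Every complex abelian
variety `A` of CM-type with `0 < dim A` is isogenous to a finite product of CM-typed abelian varieties,
granted the binder at SIMPLE abelian varieties of POSITIVE dimension: the hereditary Poincaré
decomposition into simple abelian subvarieties of positive dimension
(`exists_isogeny_from_productOf_simple_pos_of_hereditary`), CM-type at simple subvarieties
(`hSub_simple`, Shimura §5.1 Props. 3, 4, 6), products and symmetry of isogenies.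
[cite: MumfordAV1970, §19 Thm. 1 Cor. 1 (pp. 173–174)] [cite: Shimura1998, §5.1 Props. 3–6, §5.2, §7.1 Prop. 7]
[cite: Milne1999, §2 p. 54] -/
theorem hDecompPos_of_hSimplePos
    (hSimplePos : ∀ B : AbelianVariety ℂ, AbelianVariety.IsSimple B → 0 < B.dim → IsOfCMType B →
      ∃ B' : AbelianVariety ℂ, IsCMTyped B' ∧ AbelianVariety.IsIsogenous B B') :
    ∀ A : AbelianVariety ℂ, 0 < A.dim → IsOfCMType A →
      ∃ B : AbelianVariety ℂ, AbelianVariety.IsProductOf IsCMTyped B ∧ AbelianVariety.IsIsogenous A B := by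
  intro A hA0 hA
  obtain ⟨P, g, hP, hg⟩ :=
    AbelianVariety.exists_isogeny_from_productOf_simple_pos_of_hereditary
      (fun B ↦ ∃ f : B ⟶ A, IsClosedImmersion (AbelianVariety.Hom.toSchemeHom f))
      (fun B C f hf ⟨i, hi⟩ ↦ ⟨f ≫ i, by
        haveI := hf; haveI := hi
        change IsClosedImmersion (AbelianVariety.Hom.toSchemeHom f ≫ AbelianVariety.Hom.toSchemeHom i)
        infer_instance⟩)
      A ⟨𝟙 A, by change IsClosedImmersion (𝟙 A.X.left); infer_instance⟩ hA0
  obtain ⟨P', hP', hPP'⟩ := exists_isProductOf_isCMTyped_of_atoms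
    (fun B ⟨hs, hB0, i, hi⟩ ↦ by
      haveI := hi
      exact hSimplePos B hs hB0 (isOfCMType_of_isSimple_of_isClosedImmersion hA hs i)) hP
  exact ⟨P', hP', (AbelianVariety.IsIsogenous.symm_of_charZero (A := P) (B := A) ⟨g, hg⟩).trans hPP'⟩

/-- **Guarded CM domination**: under `Shimura1998_Thm2_Cor` and the guarded decomposition, every
complex abelian variety of CM-type of POSITIVE dimension is isogenous to the interpretation of a
CM-flagged code. [cite: Shimura1998, §6.1 Corollary of Theorem 2 (p. 41)] -/
theorem hDomPos_of_hDecompPos (hcor : Shimura1998_Thm2_Cor)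
    (hU : PicardCM.BallQuotientUniformisedDatum) (h₃ : PicardCM.CMAbelianVarietyRealised)
    (hDecompPos : ∀ A : AbelianVariety ℂ, 0 < A.dim → IsOfCMType A →
      ∃ B : AbelianVariety ℂ, AbelianVariety.IsProductOf IsCMTyped B ∧ AbelianVariety.IsIsogenous A B) :
    ∀ A : AbelianVariety ℂ, 0 < A.dim → IsOfCMType A →
      ∃ (v : PicardCM.Var) (B : AbelianVariety ℂ), PicardCM.Var.IsCMAbelianVariety h₃ v ∧
        B.X = PicardCM.Var.scheme hU h₃ v ∧ AbelianVariety.IsIsogenous A B := by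
  intro A hA0 hCM
  obtain ⟨B, hB, hAB⟩ := hDecompPos A hA0 hCM
  obtain ⟨v, C, hv, hC, hBC⟩ := exists_coded_isogenous_of_isProductOf_isCMTyped hcor hU h₃ hB
  exact ⟨v, C, hv, hC, hAB.trans hBC⟩

/-- **(I) ⟹ (H) over guarded CM domination.**  From the Hodge conjecture on the realised CM codes
(`CodesHC`) and CM domination at POSITIVE dimension (`hDomPos`), Milne's hypothesis (H)
`∀ A, CMHodgeHypothesisAt A`: at dimension `0` the Hodge conjecture is the tree's unconditional
theorem in dimension `≤ 3` (`hodgeConjectureFor_of_dim_le_three_holds`); at positive dimension the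
argument of `forall_cmHodgeHypothesisAt_of_codesHC` (comparison code by code, isogeny invariance
`isogenyInvariance_hodgeConjectureFor`, model-independence `hodgePQ_independent_of_hodgeModel_holds`).
[cite: Milne1999, §2 p. 54 and §7 p. 72] [cite: vanGeemen1994HodgeAV, Lemma 3.7 (p. 236)]
[cite: VoisinHodgeII2003, proof of Prop. 10.26] -/
theorem forall_cmHodgeHypothesisAt_of_codesHC_pos
    {hHD : exists_isReal_hodgeModel}
    {hU : PicardCM.BallQuotientUniformisedDatum} {h₃ : PicardCM.CMAbelianVarietyRealised}
    (hC : CodesHC hHD hU h₃)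
    (hDomPos : ∀ A : AbelianVariety ℂ, 0 < A.dim → IsOfCMType A →
      ∃ (v : PicardCM.Var) (B : AbelianVariety ℂ), PicardCM.Var.IsCMAbelianVariety h₃ v ∧
        B.X = PicardCM.Var.scheme hU h₃ v ∧ AbelianVariety.IsIsogenous A B) :
    ∀ A : AbelianVariety ℂ, CMHodgeHypothesisAt A := by
  intro A hA hCM
  by_cases hA0 : A.dim = 0
  · exact hodgeConjectureFor_of_dim_le_three_holds (by omega) hA
  obtain ⟨v, B, hv, hBX, hAB⟩ := hDomPos A (Nat.pos_of_ne_zero hA0) hCM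
  have hB : HodgeConjectureFor v.dim (PicardCM.Var.scheme hU h₃ v) :=
    (hodgeClasses_le_ratAlgebraicClasses_iff_hodgeConjectureFor hHD hodgePQ_independent_of_hodgeModel_holds
      (PicardCM.Var.isSmoothProjective hU h₃ v)).1 (hC v hv)
  have hdim : B.dim = v.dim := by
    rw [AbelianVariety.dim, hBX]
    exact schemeDim_eq_holds (PicardCM.Var.isSmoothProjective hU h₃ v)
  rw [← hBX, ← hdim] at hB
  exact isogenyInvariance_hodgeConjectureFor A B hAB hB

/-- **(I) ⟹ (H) over the guarded binder `hSimplePos`** (with `Shimura1998_Thm2_Cor`; everything else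
kernel). [cite: Milne1999, §2 p. 54 and §7 p. 72] [cite: Shimura1998, §6.1 Corollary of Theorem 2 (p. 41)] -/
theorem forall_cmHodgeHypothesisAt_of_codesHC_of_hSimplePos
    {hHD : exists_isReal_hodgeModel}
    {hU : PicardCM.BallQuotientUniformisedDatum} {h₃ : PicardCM.CMAbelianVarietyRealised}
    (hC : CodesHC hHD hU h₃) (hcor : Shimura1998_Thm2_Cor)
    (hSimplePos : ∀ B : AbelianVariety ℂ, AbelianVariety.IsSimple B → 0 < B.dim → IsOfCMType B →
      ∃ B' : AbelianVariety ℂ, IsCMTyped B' ∧ AbelianVariety.IsIsogenous B B') :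
    ∀ A : AbelianVariety ℂ, CMHodgeHypothesisAt A :=
  forall_cmHodgeHypothesisAt_of_codesHC_pos hC
    (hDomPos_of_hDecompPos hcor hU h₃ (hDecompPos_of_hSimplePos hSimplePos))

/-- **(H) ⟺ (I) over the guarded binder** ((H) ⟹ (I) needs nothing:
`codesHC_of_forall_cmHodgeHypothesisAt`). [cite: Milne1999, §2 p. 54 and §7 p. 72]
[cite: Shimura1998, §6.1 Corollary of Theorem 2 (p. 41)] -/
theorem forall_cmHodgeHypothesisAt_iff_codesHC_pos
    {hHD : exists_isReal_hodgeModel}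
    {hU : PicardCM.BallQuotientUniformisedDatum} {h₃ : PicardCM.CMAbelianVarietyRealised}
    (hcor : Shimura1998_Thm2_Cor)
    (hSimplePos : ∀ B : AbelianVariety ℂ, AbelianVariety.IsSimple B → 0 < B.dim → IsOfCMType B →
      ∃ B' : AbelianVariety ℂ, IsCMTyped B' ∧ AbelianVariety.IsIsogenous B B') :
    (∀ A : AbelianVariety ℂ, CMHodgeHypothesisAt A) ↔ CodesHC hHD hU h₃ :=
  ⟨codesHC_of_forall_cmHodgeHypothesisAt,
    fun hC ↦ forall_cmHodgeHypothesisAt_of_codesHC_of_hSimplePos hC hcor hSimplePos⟩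

/-- **The kernel-visible chain (I) ⟹ (H) ⟹ Tate over the guarded binder `hSimplePos`.**
[cite: Milne1999, §7 Thm. 7.1 p. 72] [cite: Shimura1998, §6.1 Corollary of Theorem 2 (p. 41)] -/
theorem tateAV_Fq_of_codesHC_pos
    {E : ∀ (k : Type) [Field k] [Finite k] (ℓ : ℕ) [Fact ℓ.Prime] [NeZero (ℓ : k)],
      GaloisWeilCohomology k ℚ_[ℓ] (padicCyclotomicCharacter k ℓ)}
    (h71 : Theorem71 E)
    {hHD : exists_isReal_hodgeModel}
    {hU : PicardCM.BallQuotientUniformisedDatum} {h₃ : PicardCM.CMAbelianVarietyRealised}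
    (hC : CodesHC hHD hU h₃) (hcor : Shimura1998_Thm2_Cor)
    (hSimplePos : ∀ B : AbelianVariety ℂ, AbelianVariety.IsSimple B → 0 < B.dim → IsOfCMType B →
      ∃ B' : AbelianVariety ℂ, IsCMTyped B' ∧ AbelianVariety.IsIsogenous B B') :
    TateStatement01 E :=
  tateAV_Fq_of_HC_CM h71 (forall_cmHodgeHypothesisAt_of_codesHC_of_hSimplePos hC hcor hSimplePos)

/-- **(I) ⟹ (H) ⟹ Tate over finite fields AND `D`, `Hdg` for abelian varieties over an algebraically
closed field, over the guarded binder.** [cite: Milne1999, §7 Thm. 7.1 p. 72]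
[cite: Milne2002Polarizations, Thm. 3.3 p. 607] [cite: Shimura1998, §6.1 Corollary of Theorem 2 (p. 41)] -/
theorem tate_and_hodgeStandard_of_codesHC_pos
    {k : Type} [Field k] [IsAlgClosed k] {ℓ : ℕ} [Fact ℓ.Prime] [NeZero (ℓ : k)]
    {W : WeilCohomology k ℚ_[ℓ]}
    {E : ∀ (k' : Type) [Field k'] [Finite k'] (ℓ' : ℕ) [Fact ℓ'.Prime] [NeZero (ℓ' : k')],
      GaloisWeilCohomology k' ℚ_[ℓ'] (padicCyclotomicCharacter k' ℓ')}
    (h71 : Theorem71 E) (h33 : Milne2002.Theorem33 ℓ W)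
    {hHD : exists_isReal_hodgeModel}
    {hU : PicardCM.BallQuotientUniformisedDatum} {h₃ : PicardCM.CMAbelianVarietyRealised}
    (hC : CodesHC hHD hU h₃) (hcor : Shimura1998_Thm2_Cor)
    (hSimplePos : ∀ B : AbelianVariety ℂ, AbelianVariety.IsSimple B → 0 < B.dim → IsOfCMType B →
      ∃ B' : AbelianVariety ℂ, IsCMTyped B' ∧ AbelianVariety.IsIsogenous B B') :
    TateStatement01 E ∧ ∀ A : AbelianVariety k, W.StandardConjectureD A.dim A.X ∧
      ∀ η : W.obj A.X 2, W.IsHyperplaneClass A.X η → W.StandardConjectureHdg A.dim A.X η :=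
  Milne2002.tate_and_hodgeStandard_of_HC_CM h71 h33
    (forall_cmHodgeHypothesisAt_of_codesHC_of_hSimplePos hC hcor hSimplePos)

/-- With (H) read in Milne's wording (`IsOfCMTypeMilne`, file `CMTypeSimpleIsogenyFactors`): from
`CodesHC`, `Shimura1998_Thm2_Cor` and `hSimplePos`, the Hodge conjecture for every complex abelian
variety all of whose simple isogeny factors have `End⁰` a field of degree `2 dim`.
[cite: Milne1999, §2 p. 54 and §7 p. 72] -/
theorem forall_hodgeConjectureFor_of_isOfCMTypeMilne_of_codesHC_pos
    {hHD : exists_isReal_hodgeModel}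
    {hU : PicardCM.BallQuotientUniformisedDatum} {h₃ : PicardCM.CMAbelianVarietyRealised}
    (hC : CodesHC hHD hU h₃) (hcor : Shimura1998_Thm2_Cor)
    (hSimplePos : ∀ B : AbelianVariety ℂ, AbelianVariety.IsSimple B → 0 < B.dim → IsOfCMType B →
      ∃ B' : AbelianVariety ℂ, IsCMTyped B' ∧ AbelianVariety.IsIsogenous B B') :
    ∀ A : AbelianVariety ℂ, IsSmoothProjective A.dim A.X → IsOfCMTypeMilne A →
      HodgeConjectureFor A.dim A.X :=
  forall_cmHodgeHypothesisAt_iff_milneDef.1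
    (forall_cmHodgeHypothesisAt_of_codesHC_of_hSimplePos hC hcor hSimplePos)

end Literature.AlgebraicGeometry.Milne1999

end
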